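import Mathlib
import HarnessLib
import Summits.NavierStokesRegularity.NavierStokesRegularity.Theorems.UnthreadedDoorNetFluxDefs
import Summits.NavierStokesRegularity.NavierStokesRegularity.Theorems.UnthreadedDoorNetFluxStratumOneSidedLaw
import Summits.NavierStokesRegularity.NavierStokesRegularity.Theorems.UnthreadedDoorNetFluxStratumWindowDecay
import Summits.NavierStokesRegularity.NavierStokesRegularity.Theorems.UnthreadedDoorNetFluxStratumLiouville
import Summits.NavierStokesRegularity.NavierStokesRegularity.Theorems.UnthreadedDoorNetFluxStratumReduction
import Summits.NavierStokesRegularity.NavierStokesRegularity.Theorems.UnthreadedDoorNetFluxOscLeVorticity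
import Summits.NavierStokesRegularity.NavierStokesRegularity.Theorems.UnthreadedDoorNetFluxNearCentreFlux
import Summits.NavierStokesRegularity.NavierStokesRegularity.Theorems.UnthreadedDoorNetFluxLevelLipschitzAnalytic
import Summits.NavierStokesRegularity.NavierStokesRegularity.Theorems.UnthreadedDoorNetFluxNF1aExtremalHeadEMFOfLevelLip
import Summits.NavierStokesRegularity.NavierStokesRegularity.Theorems.UnthreadedDoorNetFluxNSSpatialAnalyticity
import Summits.NavierStokesRegularity.NavierStokesRegularity.Theorems.UnthreadedDoorNetFluxAnalyticRadialGauge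
import Summits.NavierStokesRegularity.NavierStokesRegularity.Theorems.UnthreadedDoorNetFluxCurledLawRadialGauge

/-!
# Route `UnthreadedDoor`, crux `PoloidalLiouville` (stmt-NavierStokesRegularity-1222), WALL W1 — LINE `height_head`:
# THE SECOND-STRATUM RUNG K3ᶠ `DenseFiniteZeroScalarLiouvilleTypeI`, Theorems side, BY NAME

`denseFiniteZeroScalarLiouvilleTypeI_holds` = the body of ns-idea-14's generic target
`HeightHead.DenseFiniteZeroScalarLiouvilleTypeI` (`Cruxes/PoloidalLiouville/Lines/height_head.lean` v2, l.630–641) VERBATIM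
with `sphCrit (T t) x₀ r` unfolded to its body: a bounded ancient mild solution (duality form), Type-I in time, smooth on the past
slab, unthreaded about `x₀` (`curl v = ∇T × (x − x₀)`, `T` bounded and smooth off `x₀`, curled law (E1)), such that at every
`t < 0` the radii `r` whose sphere `S_r(x₀)` carries FINITELY many vorticity zeros are dense in `(0, ∞)`, has `ω ≡ 0`.

Composition (all pieces are landed Theorems; this file only re-does, Theorems side, the kernel glue of the line file):
* hinge (a) on the analytic dense-finite-zero stratum (`extremalHeadEMF_analyticFinite`) = K1⁺
  `levelLipschitz_of_analytic_finiteCrit` (p679110) + K2 `NF1a.extremalHeadEMF_of_levelLip` (p680049) + the closure lemma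
  `sliceLevelLip_of_dense'` (slice property closed under limits of radii; port of the sketch's kernel proof) + `|m| ≤ r V`;
* the generic chain HH-3/4/5 (p678532/p678535/p678536 with `oscLeVorticity`, `nearCentreFlux`) ⇒ the Type-I scalar Liouville
  statement on that stratum (`scalarLiouvilleTypeI_analyticFinite`);
* the last mile (port of the line's HH-6 assembly): pass to the explicit radial gauge `T̃(t,x) = T(t,x) − T(t, x₀ + ‖x − x₀‖ e₀)`
  — jointly smooth off `x₀`, bounded, same `∇T × y` (HH-6c `tangentialGrad_radialGauge'`), (E1) by HH-6b `curledLawRadialGauge`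
  (p683221, ns-qj-p1), analytic slices by HH-0 `nsSpatialAnalyticity` (p682567) + HH-6a `analyticRadialGauge` (p682734), same
  sphere-critical sets — and transfer the conclusion back.

HONEST LABEL: a decided SUB-CLASS of W1 («Type-I scalar Liouville on the dense-finite-zero stratum»), strictly containing the
first rung `unimodalScalarLiouvilleTypeI_holds` (p675773); the residual `NullSheetResidualTypeI` (a vortex-null sheet) and C⁻'s
`MultiHillScalarLiouvilleTypeI`, `PoloidalLiouville` (1222), `stub_scalarLiouville`, W1 and NS regularity remain OPEN.
`--supports stmt-NavierStokesRegularity-1222 --as helper`.  [folklore]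
-/

noncomputable section

-- the summit and its single sub-problem share the name (CONVENTIONS §1)
set_option linter.dupNamespace false

open Set Function Filter Topology InnerProductSpace MeasureTheory Metric
open scoped RealInnerProductSpace ContDiff

namespace Summit.NavierStokesRegularity.NavierStokesRegularity.Theorems.PoloidalLiouville.NetFlux

open Literature.Analysis Literature.Analysis.FluidPDE

section DenseFiniteZero

/-! ### 1. The closure lemma: the slice property is closed under limits of radii -/

/-- **Closure lemma** (port of the sketch's `HeightHead.sliceLevelLip_of_dense`, ns-idea-14): if `P, T` are continuous off
`x₀` and the slice inequality `|P x − P y| ≤ (r·V) |T x − T y|` holds on every sphere `S_r(x₀)` for a set of radii whose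
closure contains `(0,∞)`, then it holds on EVERY sphere (radial projection to the good spheres and a limit). [folklore] -/
theorem sliceLevelLip_of_dense' {P T : E3 → ℝ} {x₀ : E3} {V : ℝ}
    (hP : ContinuousOn P ({x₀}ᶜ : Set E3)) (hT : ContinuousOn T ({x₀}ᶜ : Set E3))
    (hd : Ioi (0 : ℝ) ⊆ closure {r : ℝ | 0 < r ∧ ∀ x ∈ Metric.sphere x₀ r, ∀ y ∈ Metric.sphere x₀ r,
        |P x - P y| ≤ (r * V) * |T x - T y|}) :
    ∀ r > 0, ∀ x ∈ Metric.sphere x₀ r, ∀ y ∈ Metric.sphere x₀ r, |P x - P y| ≤ (r * V) * |T x - T y| := by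
  intro r hr x hx y hy
  -- radial projection to the sphere of radius `ρ`
  set sc : ℝ → E3 → E3 := fun ρ z => x₀ + (ρ / r) • (z - x₀) with hsc
  have hmem : ∀ {z : E3}, z ∈ Metric.sphere x₀ r → ∀ {ρ : ℝ}, 0 < ρ → sc ρ z ∈ Metric.sphere x₀ ρ := by
    intro z hz ρ hρ
    rw [mem_sphere_iff_norm] at hz ⊢
    simp only [hsc, add_sub_cancel_left, norm_smul, Real.norm_eq_abs, hz]
    rw [abs_of_pos (div_pos hρ hr), div_mul_cancel₀ _ hr.ne']
  have hne : ∀ {z : E3}, z ∈ Metric.sphere x₀ r → ∀ {ρ : ℝ}, 0 < ρ → sc ρ z ∈ ({x₀}ᶜ : Set E3) := by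
    intro z hz ρ hρ h0
    have h1 := hmem hz hρ
    rw [mem_sphere_iff_norm, Set.mem_singleton_iff.1 h0, sub_self, norm_zero] at h1
    exact hρ.ne' h1.symm
  have hsc_r : ∀ z : E3, sc r z = z := by
    intro z; simp [hsc, div_self hr.ne']
  have hcont_sc : ∀ z : E3, Continuous (fun ρ : ℝ => sc ρ z) := by
    intro z
    simp only [hsc]
    fun_prop
  have hlimF : ∀ (F : E3 → ℝ), ContinuousOn F ({x₀}ᶜ : Set E3) → ∀ {z : E3}, z ∈ Metric.sphere x₀ r →
      Tendsto (fun ρ : ℝ => F (sc ρ z)) (𝓝[Ioi 0] r) (𝓝 (F z)) := by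
    intro F hF z hz
    have hz0 : z ∈ ({x₀}ᶜ : Set E3) := by simpa [hsc_r] using hne hz hr
    have h1 : Tendsto (fun ρ : ℝ => sc ρ z) (𝓝[Ioi 0] r) (𝓝[({x₀}ᶜ : Set E3)] z) := by
      refine tendsto_nhdsWithin_iff.2 ⟨?_, ?_⟩
      · have := ((hcont_sc z).tendsto r)
        rw [hsc_r] at this
        exact this.mono_left nhdsWithin_le_nhds
      · filter_upwards [self_mem_nhdsWithin] with ρ hρ using hne hz hρ
    exact ((hF z hz0).tendsto).comp h1
  -- the inequality holds frequently near `r` (density), hence in the limit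
  have hfreq : ∃ᶠ ρ in 𝓝[Ioi 0] r, |P (sc ρ x) - P (sc ρ y)| ≤ (ρ * V) * |T (sc ρ x) - T (sc ρ y)| := by
    set A : Set ℝ := {ρ : ℝ | 0 < ρ ∧ ∀ x ∈ Metric.sphere x₀ ρ, ∀ y ∈ Metric.sphere x₀ ρ,
        |P x - P y| ≤ (ρ * V) * |T x - T y|} with hA
    have hAsub : A ⊆ Ioi 0 := fun ρ hρ => hρ.1
    have hrcl : r ∈ closure (A ∩ Ioi 0) := by
      rw [Set.inter_eq_left.2 hAsub]; exact hd hr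
    have h1 : ∃ᶠ ρ in 𝓝[Ioi 0] r, ρ ∈ A := by
      rw [mem_closure_iff_nhdsWithin_neBot] at hrcl
      have : 𝓝[A ∩ Ioi 0] r ≤ 𝓝[Ioi 0] r := nhdsWithin_mono r Set.inter_subset_right
      rw [Filter.Frequently]
      intro hev
      have hev' : ∀ᶠ ρ in 𝓝[A ∩ Ioi 0] r, ρ ∉ A := this hev
      have hin : ∀ᶠ ρ in 𝓝[A ∩ Ioi 0] r, ρ ∈ A :=
        eventually_nhdsWithin_of_forall (fun ρ hρ => hρ.1)
      obtain ⟨ρ, h1, h2⟩ := (hev'.and hin).exists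
      exact h1 h2
    exact h1.mono (fun ρ hρ => hρ.2 _ (hmem hx hρ.1) _ (hmem hy hρ.1))
  have hlim1 : Tendsto (fun ρ : ℝ => |P (sc ρ x) - P (sc ρ y)|) (𝓝[Ioi 0] r) (𝓝 (|P x - P y|)) :=
    ((hlimF P hP hx).sub (hlimF P hP hy)).abs
  have hlim2 : Tendsto (fun ρ : ℝ => (ρ * V) * |T (sc ρ x) - T (sc ρ y)|) (𝓝[Ioi 0] r)
      (𝓝 ((r * V) * |T x - T y|)) :=
    ((tendsto_nhdsWithin_of_tendsto_nhds tendsto_id).mul_const V).mul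
      (((hlimF T hT hx).sub (hlimF T hT hy)).abs)
  exact le_of_tendsto_of_tendsto_of_frequently hlim1 hlim2 hfreq

/-! ### 2. Hinge (a) on the analytic dense-finite-zero stratum -/

/-- The loop momentum `m = ⟪v, · − x₀⟫` is analytic where `v` is (port of the sketch's `analyticOnNhd_loopMomentum`).
[folklore] -/
theorem analyticOnNhd_loopMomentum' {v : E3 → E3} {s : Set E3} (hv : AnalyticOnNhd ℝ v s) (x₀ : E3) :
    AnalyticOnNhd ℝ (fun x => ⟪v x, x - x₀⟫) s := by
  have hid : AnalyticOnNhd ℝ (fun x : E3 => x - x₀) s := analyticOnNhd_id.sub analyticOnNhd_const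
  have hb := (innerSL ℝ (E := E3)).analyticOnNhd_bilinear (univ : Set (E3 × E3))
  have h := hb.comp (hv.prod hid) (fun _ _ => mem_univ _)
  have hfun : ((fun x : E3 × E3 => ((innerSL ℝ) x.1) x.2) ∘ fun x => (v x, x - x₀)) = fun x => ⟪v x, x - x₀⟫ := by
    funext x; simp [Function.comp]
  rw [hfun] at h
  exact h

/-- **Hinge (a) `ExtremalHeadEMF` on the analytic dense-finite-zero stratum** (the hypothesis `hA` of the generic NF-1cᵛ
`oneSidedNetFluxLawOn_of_extremalHeadEMFOn` for the stratum predicate «`v t` analytic on `ℝ³`, `T t` analytic off `x₀`, the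
finite-zero radii dense»): K1⁺ `levelLipschitz_of_analytic_finiteCrit` on the good radii (with `|m| ≤ r V(t)` by
Cauchy–Schwarz), the closure lemma on all radii, then K2 `NF1a.extremalHeadEMF_of_levelLip`. [folklore] -/
theorem extremalHeadEMF_analyticFinite :
    ∀ (v : ℝ → E3 → E3) (x₀ : E3) (T P : ℝ → E3 → ℝ) (V : ℝ → ℝ) (t₀ : ℝ),
      ContDiffOn ℝ (⊤ : ℕ∞) (uncurry v) (Ioo t₀ 0 ×ˢ univ) →
      ContDiffOn ℝ (⊤ : ℕ∞) (uncurry T) (Ioo t₀ 0 ×ˢ ({x₀}ᶜ : Set E3)) →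
      (∀ t ∈ Ioo t₀ 0, ContDiffOn ℝ 1 (P t) ({x₀}ᶜ : Set E3)) →
      (∀ t ∈ Ioo t₀ 0, ∀ x, ‖v t x‖ ≤ V t) →
      (∀ t ∈ Ioo t₀ 0, ∀ x, x ≠ x₀ →
          cross (gradient (P t) x - (inner ℝ (v t x) (x - x₀)) • gradient (T t) x) (x - x₀) = 0) →
      (∀ t ∈ Ioo t₀ 0, AnalyticOnNhd ℝ (v t) (univ : Set E3) ∧ AnalyticOnNhd ℝ (T t) ({x₀}ᶜ : Set E3) ∧
          Ioi (0 : ℝ) ⊆ closure {r : ℝ | 0 < r ∧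
            {x : E3 | x ∈ Metric.sphere x₀ r ∧ cross (gradient (T t) x) (x - x₀) = 0}.Finite}) →
      ∃ I : ℝ → ℝ → ℝ,
        (∀ t ∈ Ioo t₀ 0, ∀ r > 0, ∀ xp ∈ sphArgmax (T t) x₀ r, ∀ xm ∈ sphArgmin (T t) x₀ r,
            I t r = P t xp - P t xm) ∧
        ContinuousOn (uncurry I) (Ioo t₀ 0 ×ˢ Ioi 0) ∧
        (∀ t ∈ Ioo t₀ 0, ∀ a b : ℝ, 0 < a → a < b → ∃ L : NNReal, LipschitzOnWith L (I t) (Icc a b)) ∧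
        (∀ t ∈ Ioo t₀ 0, ∀ r > 0, |I t r| ≤ V t * netFlux (T t) x₀ r) ∧
        (∀ t ∈ Ioo t₀ 0, ∀ᵐ r : ℝ, 0 < r →
            deriv (I t) r ≤ sSup (radDeriv (P t) x₀ '' sphArgmax (T t) x₀ r)
                            - sInf (radDeriv (P t) x₀ '' sphArgmin (T t) x₀ r)) := by
  intro v x₀ T P V t₀ hv hT hP hV hhead hS
  refine NF1a.extremalHeadEMF_of_levelLip v x₀ T P V t₀ hv hT hP hV hhead (fun t ht => ?_)
  obtain ⟨hva, hTa, hdense⟩ := hS t ht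
  have hPc : ContinuousOn (P t) ({x₀}ᶜ : Set E3) := (hP t ht).continuousOn
  have hTc : ContinuousOn (T t) ({x₀}ᶜ : Set E3) := hTa.continuousOn
  refine sliceLevelLip_of_dense' (V := V t) hPc hTc (hdense.trans (closure_mono ?_))
  rintro r ⟨hr, hQ⟩
  refine ⟨hr, ?_⟩
  have hμa : AnalyticOnNhd ℝ (fun x => ⟪v t x, x - x₀⟫) ({x₀}ᶜ : Set E3) :=
    (analyticOnNhd_loopMomentum' hva x₀).mono (subset_univ _)
  have hne : ∀ x ∈ Metric.sphere x₀ r, x ≠ x₀ := by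
    intro x hx hxe
    rw [mem_sphere_iff_norm, hxe, sub_self, norm_zero] at hx
    exact hr.ne' hx.symm
  refine levelLipschitz_of_analytic_finiteCrit (T t) (P t) (fun x => ⟪v t x, x - x₀⟫) x₀ r (r * V t) hr hTa
    (hP t ht) hμa (fun x hx => hhead t ht x (hne x hx)) (fun x hx => ?_) hQ
  have hxr : ‖x - x₀‖ = r := mem_sphere_iff_norm.mp hx
  calc |⟪v t x, x - x₀⟫| ≤ ‖v t x‖ * ‖x - x₀‖ := abs_real_inner_le_norm _ _
    _ ≤ V t * r := by
        rw [hxr]; exact mul_le_mul_of_nonneg_right (hV t ht x) hr.le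
    _ = r * V t := mul_comm _ _

/-! ### 3. The Type-I scalar Liouville statement on the analytic dense-finite-zero stratum -/

/-- **Type-I scalar Liouville on the analytic dense-finite-zero stratum** — the generic chain NF-1cᵛ ∘ NF-4ᵛ ∘ (S⁺ ⇒ target)
(`oneSidedNetFluxLawOn_of_extremalHeadEMFOn`, `netFluxWindowDecayOn_of_laws` with `oscLeVorticity`/`nearCentreFlux`,
`scalarLiouvilleTypeIOn_of_netFluxWindowDecayOn`) fed with `extremalHeadEMF_analyticFinite`. [folklore] -/
theorem scalarLiouvilleTypeI_analyticFinite :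
    ∀ (v : ℝ → E3 → E3) (x₀ : E3) (T : ℝ → E3 → ℝ),
      (∃ C : ℝ, HasTypeITimeDecay C v) →
      IsBoundedAncientMildSolution 1 v →
      (∀ t < 0, AEStronglyMeasurable (v t) volume) →
      ContDiffOn ℝ (⊤ : ℕ∞) (uncurry v) (Iio 0 ×ˢ univ) →
      ContDiffOn ℝ (⊤ : ℕ∞) (uncurry T) (Iio 0 ×ˢ ({x₀}ᶜ : Set E3)) →
      (∃ C : ℝ, ∀ t < 0, ∀ x, |T t x| ≤ C) →
      (∀ t < 0, ∀ x, curl (v t) x = cross (gradient (T t) x) (x - x₀)) →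
      CurledLaw v x₀ T (Iio 0) →
      (∀ t < 0, AnalyticOnNhd ℝ (v t) (univ : Set E3) ∧ AnalyticOnNhd ℝ (T t) ({x₀}ᶜ : Set E3) ∧
          Ioi (0 : ℝ) ⊆ closure {r : ℝ | 0 < r ∧
            {x : E3 | x ∈ Metric.sphere x₀ r ∧ cross (gradient (T t) x) (x - x₀) = 0}.Finite}) →
      ∀ t < 0, ∀ x, cross (gradient (T t) x) (x - x₀) = 0 :=
  scalarLiouvilleTypeIOn_of_netFluxWindowDecayOn
    (fun v x₀ T t => AnalyticOnNhd ℝ (v t) (univ : Set E3) ∧ AnalyticOnNhd ℝ (T t) ({x₀}ᶜ : Set E3) ∧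
      Ioi (0 : ℝ) ⊆ closure {r : ℝ | 0 < r ∧
        {x : E3 | x ∈ Metric.sphere x₀ r ∧ cross (gradient (T t) x) (x - x₀) = 0}.Finite})
    (netFluxWindowDecayOn_of_laws
      (fun v x₀ T t => AnalyticOnNhd ℝ (v t) (univ : Set E3) ∧ AnalyticOnNhd ℝ (T t) ({x₀}ᶜ : Set E3) ∧
        Ioi (0 : ℝ) ⊆ closure {r : ℝ | 0 < r ∧
          {x : E3 | x ∈ Metric.sphere x₀ r ∧ cross (gradient (T t) x) (x - x₀) = 0}.Finite})
      (oneSidedNetFluxLawOn_of_extremalHeadEMFOn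
        (fun v x₀ T t => AnalyticOnNhd ℝ (v t) (univ : Set E3) ∧ AnalyticOnNhd ℝ (T t) ({x₀}ᶜ : Set E3) ∧
          Ioi (0 : ℝ) ⊆ closure {r : ℝ | 0 < r ∧
            {x : E3 | x ∈ Metric.sphere x₀ r ∧ cross (gradient (T t) x) (x - x₀) = 0}.Finite})
        extremalHeadEMF_analyticFinite)
      oscLeVorticity nearCentreFlux)

/-! ### 4. The radial gauge and the rung -/

/-- **HH-6c (port of the line's `tangentialGrad_radialGauge`): a radial summand `ρ(‖x − x₀‖)` does not change the tangential
gradient `∇T × (x − x₀)`** (the summand's gradient is `(ρ′/r)(x − x₀)`, `NetFlux.hasGradientAt_radialFun`). [folklore] -/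
theorem tangentialGrad_radialGauge' (T : E3 → ℝ) (ρ : ℝ → ℝ) (x₀ x : E3) (hx : x ≠ x₀)
    (hT : DifferentiableAt ℝ T x) (hρ : DifferentiableAt ℝ ρ ‖x - x₀‖) :
    cross (gradient (fun z => T z + ρ ‖z - x₀‖) x) (x - x₀) = cross (gradient T x) (x - x₀) := by
  have ha := hasGradientAt_radialFun hx hρ.hasDerivAt
  have hRd : DifferentiableAt ℝ (fun z : E3 => ρ ‖z - x₀‖) x := ha.differentiableAt
  have hsum : gradient (fun z => T z + ρ ‖z - x₀‖) x = gradient T x + gradient (fun z : E3 => ρ ‖z - x₀‖) x := by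
    unfold gradient
    rw [fderiv_fun_add hT hRd, map_add]
  have h3 : ∀ (a b c : E3) (t : ℝ), cross (a + t • b) c = cross a c + t • cross b c := by
    intro a b c t
    rw [← crossCLM_apply, ← crossCLM_apply a c, ← crossCLM_apply b c, map_add, map_smul]
    rfl
  have h4 : cross (x - x₀) (x - x₀) = 0 := by simp [cross]
  rw [hsum, ha.gradient, h3, h4, smul_zero, add_zero]

/-- **THE SECOND-STRATUM RUNG K3ᶠ, BY NAME: `HeightHead.DenseFiniteZeroScalarLiouvilleTypeI` (line `height_head` v2,
l.630–641) — binders VERBATIM with `sphCrit` unfolded.**  Bounded ancient mild NS (duality form), Type-I in time, smooth on the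
past slab, unthreaded about `x₀` with the curled law (E1), and at every `t < 0` the finite-vorticity-zero radii dense ⟹ `ω ≡ 0`.
Proof = port of the line's HH-6 assembly over the landed HH-0 / HH-6a / HH-6b and `scalarLiouvilleTypeI_analyticFinite`: pass to the
explicit gauge `T̃ = T − T(·, x₀ + ‖· − x₀‖ e₀)`, transfer every hypothesis, apply, transfer the conclusion back (HH-6c).
HONEST: a decided sub-class of W1; the residual `NullSheetResidualTypeI`, 1222, W1 and NS regularity are OPEN. [folklore] -/
theorem denseFiniteZeroScalarLiouvilleTypeI_holds :
    ∀ (v : ℝ → E3 → E3) (x₀ : E3) (T : ℝ → E3 → ℝ),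
      (∃ C : ℝ, HasTypeITimeDecay C v) →
      IsBoundedAncientMildSolution 1 v →
      (∀ t < 0, AEStronglyMeasurable (v t) volume) →
      ContDiffOn ℝ (⊤ : ℕ∞) (uncurry v) (Iio 0 ×ˢ univ) →
      ContDiffOn ℝ (⊤ : ℕ∞) (uncurry T) (Iio 0 ×ˢ ({x₀}ᶜ : Set E3)) →
      (∃ C : ℝ, ∀ t < 0, ∀ x, |T t x| ≤ C) →
      (∀ t < 0, ∀ x, curl (v t) x = cross (gradient (T t) x) (x - x₀)) →
      CurledLaw v x₀ T (Iio 0) →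
      (∀ t < 0, Ioi (0 : ℝ) ⊆ closure {r : ℝ | 0 < r ∧
          {x : E3 | x ∈ Metric.sphere x₀ r ∧ cross (gradient (T t) x) (x - x₀) = 0}.Finite}) →
      ∀ t < 0, ∀ x, cross (gradient (T t) x) (x - x₀) = 0 := by
  intro v x₀ T hC hB hm hsv hsT hTb hrep hE hfin
  -- the gauge direction: a unit vector
  obtain ⟨σ₀, hσ₀⟩ : ∃ σ₀ : E3, ‖σ₀‖ = 1 :=
    ⟨EuclideanSpace.single (0 : Fin 3) (1 : ℝ), by simp⟩
  have hσ₀ne : σ₀ ≠ 0 := by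
    intro h; rw [h, norm_zero] at hσ₀; exact zero_ne_one hσ₀
  have hray : ∀ r : ℝ, r ≠ 0 → x₀ + r • σ₀ ≠ x₀ := by
    intro r hr h
    have h' : r • σ₀ = 0 := by simpa using h
    exact smul_ne_zero hr hσ₀ne h'
  -- the radial summand and the gauged potential
  set c : ℝ → ℝ → ℝ := fun t r => -T t (x₀ + r • σ₀) with hcdef
  set T' : ℝ → E3 → ℝ := fun t x => T t x + c t ‖x - x₀‖ with hT'def
  -- slices of `T` are smooth off `x₀`, hence differentiable there
  have hTslice : ∀ t < 0, ContDiffOn ℝ (⊤ : ℕ∞) (T t) ({x₀}ᶜ : Set E3) := by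
    intro t ht
    have h1 : ContDiffOn ℝ (⊤ : ℕ∞) (fun x : E3 => ((t, x) : ℝ × E3)) ({x₀}ᶜ : Set E3) :=
      contDiffOn_const.prodMk contDiffOn_id
    have h2 : MapsTo (fun x : E3 => ((t, x) : ℝ × E3)) ({x₀}ᶜ : Set E3) (Iio 0 ×ˢ ({x₀}ᶜ : Set E3)) :=
      fun x hx => ⟨ht, hx⟩
    exact (hsT.comp h1 h2).congr (fun x _ => rfl)
  have hTdiff : ∀ t < 0, ∀ z : E3, z ≠ x₀ → DifferentiableAt ℝ (T t) z := by
    intro t ht z hz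
    exact ((hTslice t ht).differentiableOn (by simp)).differentiableAt (isOpen_compl_singleton.mem_nhds hz)
  have hcdiff : ∀ t < 0, ∀ r : ℝ, r ≠ 0 → DifferentiableAt ℝ (c t) r := by
    intro t ht r hr
    have h1 : DifferentiableAt ℝ (fun r : ℝ => x₀ + r • σ₀) r := by fun_prop
    exact ((hTdiff t ht _ (hray r hr)).comp r h1).neg
  -- HH-6c: the tangential gradients of `T'` and `T` agree (off `x₀` by the lemma, at `x₀` trivially)
  have hcross : ∀ t < 0, ∀ x : E3,
      cross (gradient (T' t) x) (x - x₀) = cross (gradient (T t) x) (x - x₀) := by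
    intro t ht x
    by_cases hx : x = x₀
    · rw [hx, sub_self, cross_zero_right, cross_zero_right]
    · exact tangentialGrad_radialGauge' (T t) (c t) x₀ x hx (hTdiff t ht x hx)
        (hcdiff t ht _ (norm_ne_zero_iff.2 (sub_ne_zero.2 hx)))
  -- (α) joint smoothness of `T'` off `x₀`
  have hg : ContDiffOn ℝ (⊤ : ℕ∞) (fun p : ℝ × E3 => ((p.1, x₀ + ‖p.2 - x₀‖ • σ₀) : ℝ × E3))
      (Iio 0 ×ˢ ({x₀}ᶜ : Set E3)) := by
    have hn : ContDiffOn ℝ (⊤ : ℕ∞) (fun p : ℝ × E3 => ‖p.2 - x₀‖) (Iio 0 ×ˢ ({x₀}ᶜ : Set E3)) :=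
      (contDiffOn_snd.sub contDiffOn_const).norm ℝ (fun p hp => sub_ne_zero.2 hp.2)
    exact contDiffOn_fst.prodMk (contDiffOn_const.add (hn.smul contDiffOn_const))
  have hgmaps : MapsTo (fun p : ℝ × E3 => ((p.1, x₀ + ‖p.2 - x₀‖ • σ₀) : ℝ × E3)) (Iio 0 ×ˢ ({x₀}ᶜ : Set E3))
      (Iio 0 ×ˢ ({x₀}ᶜ : Set E3)) :=
    fun p hp => ⟨hp.1, hray _ (norm_ne_zero_iff.2 (sub_ne_zero.2 hp.2))⟩
  have hsT' : ContDiffOn ℝ (⊤ : ℕ∞) (uncurry T') (Iio 0 ×ˢ ({x₀}ᶜ : Set E3)) :=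
    (hsT.add (hsT.comp hg hgmaps).neg).congr (fun p _ => rfl)
  -- (β) boundedness
  have hTb' : ∃ C : ℝ, ∀ t < 0, ∀ x, |T' t x| ≤ C := by
    obtain ⟨C, hCb⟩ := hTb
    refine ⟨C + C, fun t ht x => ?_⟩
    have h1 := hCb t ht x
    have h2 := hCb t ht (x₀ + ‖x - x₀‖ • σ₀)
    show |T t x + -T t (x₀ + ‖x - x₀‖ • σ₀)| ≤ C + C
    calc |T t x + -T t (x₀ + ‖x - x₀‖ • σ₀)| ≤ |T t x| + |-T t (x₀ + ‖x - x₀‖ • σ₀)| := abs_add_le _ _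
      _ ≤ C + C := by rw [abs_neg]; exact add_le_add h1 h2
  -- (γ) representation of the vorticity
  have hrep' : ∀ t < 0, ∀ x, curl (v t) x = cross (gradient (T' t) x) (x - x₀) := by
    intro t ht x; rw [hcross t ht x]; exact hrep t ht x
  -- (δ) the curled law (E1), by HH-6b
  have hcg : ContDiffOn ℝ (⊤ : ℕ∞) (fun p : ℝ × ℝ => ((p.1, x₀ + p.2 • σ₀) : ℝ × E3)) (Iio 0 ×ˢ Ioi (0 : ℝ)) :=
    contDiffOn_fst.prodMk (contDiffOn_const.add (contDiffOn_snd.smul contDiffOn_const))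
  have hcmaps : MapsTo (fun p : ℝ × ℝ => ((p.1, x₀ + p.2 • σ₀) : ℝ × E3)) (Iio 0 ×ˢ Ioi (0 : ℝ))
      (Iio 0 ×ˢ ({x₀}ᶜ : Set E3)) :=
    fun p hp => ⟨hp.1, hray _ (ne_of_gt hp.2)⟩
  have hc : ContDiffOn ℝ (⊤ : ℕ∞) (uncurry c) (Iio 0 ×ˢ Ioi (0 : ℝ)) :=
    ((hsT.comp hcg hcmaps).neg).congr (fun p _ => rfl)
  have hE' : CurledLaw v x₀ T' (Iio 0) := curledLawRadialGauge v x₀ T c (Iio 0) isOpen_Iio hsv hsT hc hE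
  -- (ε) the stratum: analytic slices (HH-0, HH-6a) and the same dense finite-zero radii (HH-6c)
  have hS : ∀ t < 0, AnalyticOnNhd ℝ (v t) (univ : Set E3) ∧ AnalyticOnNhd ℝ (T' t) ({x₀}ᶜ : Set E3) ∧
      Ioi (0 : ℝ) ⊆ closure {r : ℝ | 0 < r ∧
        {x : E3 | x ∈ Metric.sphere x₀ r ∧ cross (gradient (T' t) x) (x - x₀) = 0}.Finite} := by
    intro t ht
    have hva : AnalyticOnNhd ℝ (v t) (univ : Set E3) := nsSpatialAnalyticity v hB hm hsv t ht
    refine ⟨hva, ?_, ?_⟩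
    · have h := analyticRadialGauge (v t) x₀ σ₀ (T t) hσ₀ hva (hTslice t ht) (hrep t ht)
      have heq : (fun x => T t x - T t (x₀ + ‖x - x₀‖ • σ₀)) = T' t := by
        funext x; simp [hT'def, hcdef, sub_eq_add_neg]
      rw [heq] at h
      exact h
    · have hset : {r : ℝ | 0 < r ∧ {x : E3 | x ∈ Metric.sphere x₀ r ∧ cross (gradient (T' t) x) (x - x₀) = 0}.Finite}
          = {r : ℝ | 0 < r ∧ {x : E3 | x ∈ Metric.sphere x₀ r ∧ cross (gradient (T t) x) (x - x₀) = 0}.Finite} := by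
        ext r
        simp only [mem_setOf_eq, hcross t ht]
      rw [hset]
      exact hfin t ht
  -- apply the analytic-stratum statement to `T'` and transfer the conclusion back (HH-6c)
  intro t ht x
  have h := scalarLiouvilleTypeI_analyticFinite v x₀ T' hC hB hm hsv hsT' hTb' hrep' hE' hS t ht x
  rwa [hcross t ht x] at h

end DenseFiniteZero

end Summit.NavierStokesRegularity.NavierStokesRegularity.Theorems.PoloidalLiouville.NetFlux
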